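import Summits.BirchSwinnertonDyer.Rank1Residual.P2.CornerFTwoCertificatesKrizLiBases
import Literature.NumberTheory.EllipticCurves.Rank1Residual.CornerFTwoCertificates.RecordsKrizLiBases
import HarnessLib

/-!
# Cell `bsd-print-cf2` (D-0131 (2) PRINT TIER, leaf CornerF @ `p = 2`), seat ty3 — the Kriz–Li families at
# the seven (★)-CERTIFIED `j = 0` bases DISPLAYED: `BSD(·, 2)` BY NAME for every certified member, member by
# member, the (★)-certificate displayed as `hSD` (currency LITERAL-by-name((★)-certificate))

HONEST FRAMING (cell `bsd-print-cf2`, run/shared/lean/pub/bsd-print-cf2/; verbatim): PARTITION currency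
only — the leaf counts when its class theorem is in the kernel BY NAME; every imported theorem carries its
printed hypotheses verbatim. The leaf is OPEN AS A CLASS; nothing class-wide is closed here; theorems
only, no definition, no named fact. This file joins the glue `P2/CornerFTwoCertificatesKrizLiBases.lean`
to the certified record lists of `Literature/…/CornerFTwoCertificates/RecordsKrizLiBases.lean` (64 members
over the bases `1323a1`, `1323m1`, `4563a1`, `972d1`, `3888s1`, `1728a1`, `1728v1`): for every listed
member `E^{(d)}` and every globally minimal `W′` `ℚ`-isogenous to `E^{(d)}` or to its partner
`E^{(d_K·d)}`, Miller's `BSD(W′, 2)` — granted p3's seven binders `hKL h33 hS31 hBF hmod hGZK hCassels`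
(Kriz–Li Thm 5.1 (2) / Thm 4.3, Creutz–Miller, Burungale–Flach, modularity, GZK, Cassels) and the DISPLAYED
(★)-certificate `hSD : HasKrizLiStarDatum E (ℚ(√d_K))` of the pair (kernel-rechecked certificate records:
`RecordsStarJZero{Good,Bad}.lean`). In the cell's partition: finite certified samples of the generic
Kriz–Li (★)-door, aside 21366. beyond-print theorem: NO.

References: [KrizLi2019] Thm 1.12 (FMS 5.1), Thm 4.3, Def 4.1; [CreutzMiller2012] Thm 1.1;
[BurungaleFlach2024] Cor 2; [MilneADT2006] Thm I.7.3; [Miller2011LMS] Def 1.1.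
-/

noncomputable section

open scoped Classical

open WeierstrassCurve NumberField Literature.NumberTheory.EllipticCurves
  Literature.NumberTheory.EllipticCurves.Rank1Residual
  Literature.NumberTheory.EllipticCurves.ModularForms
  Literature.NumberTheory.EllipticCurves.Rank1Residual.CornerFTwoCertificates
  Summit.BirchSwinnertonDyer.Rank1Residual

set_option autoImplicit false

namespace Summit.BirchSwinnertonDyer.Rank1Residual.P2

/-- **The Kriz–Li family at `(1323a1, ℚ(√-47))`, member by member, BY NAME**: for each of the 14 certified
records `r` of `recordsKrizLiThirteenTwentyThreeA`, `BSD(W′, 2)` for every globally minimal `W′` `ℚ`-isogenous to `1323a1^{(r.d)}`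
or `1323a1^{(-47·r.d)}`, granted the seven facts and the displayed (★)-certificate `hSD`.
[cite: KrizLi2019, Thm. 1.12 (FMS Thm. 5.1 (2)), Def. 4.1, Lemma 5.1 and §6 Ex. 6.2] [cite: CreutzMiller2012, Thm. 1.1] [cite: BurungaleFlach2024, Thm. 1.1 and Cor. 2]
[cite: MilneADT2006, Thm. I.7.3] [cite: Miller2011LMS, Def. 1.1] -/
theorem bsdp_two_of_mem_recordsKrizLiThirteenTwentyThreeA (hKL : KrizLi2019.thm112_bsdTwo_twist)
    (h33 : KrizLi2019.thm33_rank_twist) (hS31 : bsdTriple_of_analyticRank_le_one_of_conductor_lt)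
    (hBF : bsdTriple_of_hasCM_of_L_one_ne_zero) (hmod : hasEntireLFunction_rat)
    (hGZK : rank_eq_analyticRank_of_analyticRank_le_one) (hCassels : bsdRHS_eq_of_isIsogenous)
    (hSD : HasKrizLiStarDatum curve1323a1 (sqrtField (-47))) :
    ∀ r ∈ recordsKrizLiThirteenTwentyThreeA, ∀ (W' : WeierstrassCurve ℚ) [W'.IsElliptic] [W'.IsGloballyMinimal],
      (IsIsogenous W' (curve1323a1.quadraticTwist ((r.d : ℤ) : ℚ)) ∨
        IsIsogenous W' (curve1323a1.quadraticTwist ((-47 * (r.d : ℤ) : ℤ) : ℚ))) → BSDp W' 2 :=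
  fun r hr W' _ _ hiso =>
    bsdp_two_of_klCertified_1323a1 hKL h33 hS31 hBF hmod hGZK hCassels hSD certified_recordsKrizLiThirteenTwentyThreeA r hr
      ((params_and_base_of_recordsKrizLiThirteenTwentyThreeA).2 r hr).1 ((params_and_base_of_recordsKrizLiThirteenTwentyThreeA).2 r hr).2.1
      ((params_and_base_of_recordsKrizLiThirteenTwentyThreeA).2 r hr).2.2.1 W' hiso

/-- **The Kriz–Li family at `(1323m1, ℚ(√-47))`, member by member, BY NAME**: for each of the 14 certified
records `r` of `recordsKrizLiThirteenTwentyThreeM`, `BSD(W′, 2)` for every globally minimal `W′` `ℚ`-isogenous to `1323m1^{(r.d)}`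
or `1323m1^{(-47·r.d)}`, granted the seven facts and the displayed (★)-certificate `hSD`.
[cite: KrizLi2019, Thm. 1.12 (FMS Thm. 5.1 (2)), Def. 4.1, Lemma 5.1 and §6 Ex. 6.2] [cite: CreutzMiller2012, Thm. 1.1] [cite: BurungaleFlach2024, Thm. 1.1 and Cor. 2]
[cite: MilneADT2006, Thm. I.7.3] [cite: Miller2011LMS, Def. 1.1] -/
theorem bsdp_two_of_mem_recordsKrizLiThirteenTwentyThreeM (hKL : KrizLi2019.thm112_bsdTwo_twist)
    (h33 : KrizLi2019.thm33_rank_twist) (hS31 : bsdTriple_of_analyticRank_le_one_of_conductor_lt)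
    (hBF : bsdTriple_of_hasCM_of_L_one_ne_zero) (hmod : hasEntireLFunction_rat)
    (hGZK : rank_eq_analyticRank_of_analyticRank_le_one) (hCassels : bsdRHS_eq_of_isIsogenous)
    (hSD : HasKrizLiStarDatum curve1323m1 (sqrtField (-47))) :
    ∀ r ∈ recordsKrizLiThirteenTwentyThreeM, ∀ (W' : WeierstrassCurve ℚ) [W'.IsElliptic] [W'.IsGloballyMinimal],
      (IsIsogenous W' (curve1323m1.quadraticTwist ((r.d : ℤ) : ℚ)) ∨
        IsIsogenous W' (curve1323m1.quadraticTwist ((-47 * (r.d : ℤ) : ℤ) : ℚ))) → BSDp W' 2 :=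
  fun r hr W' _ _ hiso =>
    bsdp_two_of_klCertified_1323m1 hKL h33 hS31 hBF hmod hGZK hCassels hSD certified_recordsKrizLiThirteenTwentyThreeM r hr
      ((params_and_base_of_recordsKrizLiThirteenTwentyThreeM).2 r hr).1 ((params_and_base_of_recordsKrizLiThirteenTwentyThreeM).2 r hr).2.1
      ((params_and_base_of_recordsKrizLiThirteenTwentyThreeM).2 r hr).2.2.1 W' hiso

/-- **The Kriz–Li family at `(4563a1, ℚ(√-23))`, member by member, BY NAME**: for each of the 4 certified
records `r` of `recordsKrizLiFortyFiveSixtyThreeA`, `BSD(W′, 2)` for every globally minimal `W′` `ℚ`-isogenous to `4563a1^{(r.d)}`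
or `4563a1^{(-23·r.d)}`, granted the seven facts and the displayed (★)-certificate `hSD`.
[cite: KrizLi2019, Thm. 1.12 (FMS Thm. 5.1 (2)), Def. 4.1, Lemma 5.1 and §6 Ex. 6.2] [cite: CreutzMiller2012, Thm. 1.1] [cite: BurungaleFlach2024, Thm. 1.1 and Cor. 2]
[cite: MilneADT2006, Thm. I.7.3] [cite: Miller2011LMS, Def. 1.1] -/
theorem bsdp_two_of_mem_recordsKrizLiFortyFiveSixtyThreeA (hKL : KrizLi2019.thm112_bsdTwo_twist)
    (h33 : KrizLi2019.thm33_rank_twist) (hS31 : bsdTriple_of_analyticRank_le_one_of_conductor_lt)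
    (hBF : bsdTriple_of_hasCM_of_L_one_ne_zero) (hmod : hasEntireLFunction_rat)
    (hGZK : rank_eq_analyticRank_of_analyticRank_le_one) (hCassels : bsdRHS_eq_of_isIsogenous)
    (hSD : HasKrizLiStarDatum curve4563a1 (sqrtField (-23))) :
    ∀ r ∈ recordsKrizLiFortyFiveSixtyThreeA, ∀ (W' : WeierstrassCurve ℚ) [W'.IsElliptic] [W'.IsGloballyMinimal],
      (IsIsogenous W' (curve4563a1.quadraticTwist ((r.d : ℤ) : ℚ)) ∨
        IsIsogenous W' (curve4563a1.quadraticTwist ((-23 * (r.d : ℤ) : ℤ) : ℚ))) → BSDp W' 2 :=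
  fun r hr W' _ _ hiso =>
    bsdp_two_of_klCertified_4563a1 hKL h33 hS31 hBF hmod hGZK hCassels hSD certified_recordsKrizLiFortyFiveSixtyThreeA r hr
      ((params_and_base_of_recordsKrizLiFortyFiveSixtyThreeA).2 r hr).1 ((params_and_base_of_recordsKrizLiFortyFiveSixtyThreeA).2 r hr).2.1
      ((params_and_base_of_recordsKrizLiFortyFiveSixtyThreeA).2 r hr).2.2.1 W' hiso

/-- **The Kriz–Li family at `(972d1, ℚ(√-23))`, member by member, BY NAME**: for each of the 10 certified
records `r` of `recordsKrizLiNineSeventyTwoD`, `BSD(W′, 2)` for every globally minimal `W′` `ℚ`-isogenous to `972d1^{(r.d)}`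
or `972d1^{(-23·r.d)}`, granted the seven facts and the displayed (★)-certificate `hSD`.
[cite: KrizLi2019, Thm. 1.12 (FMS Thm. 5.1 (2)), Def. 4.1, Lemma 5.1 and §6 Ex. 6.2] [cite: CreutzMiller2012, Thm. 1.1] [cite: BurungaleFlach2024, Thm. 1.1 and Cor. 2]
[cite: MilneADT2006, Thm. I.7.3] [cite: Miller2011LMS, Def. 1.1] -/
theorem bsdp_two_of_mem_recordsKrizLiNineSeventyTwoD (hKL : KrizLi2019.thm112_bsdTwo_twist)
    (h33 : KrizLi2019.thm33_rank_twist) (hS31 : bsdTriple_of_analyticRank_le_one_of_conductor_lt)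
    (hBF : bsdTriple_of_hasCM_of_L_one_ne_zero) (hmod : hasEntireLFunction_rat)
    (hGZK : rank_eq_analyticRank_of_analyticRank_le_one) (hCassels : bsdRHS_eq_of_isIsogenous)
    (hSD : HasKrizLiStarDatum curve972d1 (sqrtField (-23))) :
    ∀ r ∈ recordsKrizLiNineSeventyTwoD, ∀ (W' : WeierstrassCurve ℚ) [W'.IsElliptic] [W'.IsGloballyMinimal],
      (IsIsogenous W' (curve972d1.quadraticTwist ((r.d : ℤ) : ℚ)) ∨
        IsIsogenous W' (curve972d1.quadraticTwist ((-23 * (r.d : ℤ) : ℤ) : ℚ))) → BSDp W' 2 :=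
  fun r hr W' _ _ hiso =>
    bsdp_two_of_klCertified_972d1 hKL h33 hS31 hBF hmod hGZK hCassels hSD certified_recordsKrizLiNineSeventyTwoD r hr
      ((params_and_base_of_recordsKrizLiNineSeventyTwoD).2 r hr).1 ((params_and_base_of_recordsKrizLiNineSeventyTwoD).2 r hr).2.1
      ((params_and_base_of_recordsKrizLiNineSeventyTwoD).2 r hr).2.2.1 W' hiso

/-- **The Kriz–Li family at `(3888s1, ℚ(√-23))`, member by member, BY NAME**: for each of the 7 certified
records `r` of `recordsKrizLiThirtyEightEightyEightS`, `BSD(W′, 2)` for every globally minimal `W′` `ℚ`-isogenous to `3888s1^{(r.d)}`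
or `3888s1^{(-23·r.d)}`, granted the seven facts and the displayed (★)-certificate `hSD`.
[cite: KrizLi2019, Thm. 1.12 (FMS Thm. 5.1 (2)), Def. 4.1, Lemma 5.1 and §6 Ex. 6.2] [cite: CreutzMiller2012, Thm. 1.1] [cite: BurungaleFlach2024, Thm. 1.1 and Cor. 2]
[cite: MilneADT2006, Thm. I.7.3] [cite: Miller2011LMS, Def. 1.1] -/
theorem bsdp_two_of_mem_recordsKrizLiThirtyEightEightyEightS (hKL : KrizLi2019.thm112_bsdTwo_twist)
    (h33 : KrizLi2019.thm33_rank_twist) (hS31 : bsdTriple_of_analyticRank_le_one_of_conductor_lt)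
    (hBF : bsdTriple_of_hasCM_of_L_one_ne_zero) (hmod : hasEntireLFunction_rat)
    (hGZK : rank_eq_analyticRank_of_analyticRank_le_one) (hCassels : bsdRHS_eq_of_isIsogenous)
    (hSD : HasKrizLiStarDatum curve3888s1 (sqrtField (-23))) :
    ∀ r ∈ recordsKrizLiThirtyEightEightyEightS, ∀ (W' : WeierstrassCurve ℚ) [W'.IsElliptic] [W'.IsGloballyMinimal],
      (IsIsogenous W' (curve3888s1.quadraticTwist ((r.d : ℤ) : ℚ)) ∨
        IsIsogenous W' (curve3888s1.quadraticTwist ((-23 * (r.d : ℤ) : ℤ) : ℚ))) → BSDp W' 2 :=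
  fun r hr W' _ _ hiso =>
    bsdp_two_of_klCertified_3888s1 hKL h33 hS31 hBF hmod hGZK hCassels hSD certified_recordsKrizLiThirtyEightEightyEightS r hr
      ((params_and_base_of_recordsKrizLiThirtyEightEightyEightS).2 r hr).1 ((params_and_base_of_recordsKrizLiThirtyEightEightyEightS).2 r hr).2.1
      ((params_and_base_of_recordsKrizLiThirtyEightEightyEightS).2 r hr).2.2.1 W' hiso

/-- **The Kriz–Li family at `(1728a1, ℚ(√-23))`, member by member, BY NAME**: for each of the 8 certified
records `r` of `recordsKrizLiSeventeenTwentyEightA`, `BSD(W′, 2)` for every globally minimal `W′` `ℚ`-isogenous to `1728a1^{(r.d)}`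
or `1728a1^{(-23·r.d)}`, granted the seven facts and the displayed (★)-certificate `hSD`.
[cite: KrizLi2019, Thm. 1.12 (FMS Thm. 5.1 (2)), Def. 4.1, Lemma 5.1 and §6 Ex. 6.2] [cite: CreutzMiller2012, Thm. 1.1] [cite: BurungaleFlach2024, Thm. 1.1 and Cor. 2]
[cite: MilneADT2006, Thm. I.7.3] [cite: Miller2011LMS, Def. 1.1] -/
theorem bsdp_two_of_mem_recordsKrizLiSeventeenTwentyEightA (hKL : KrizLi2019.thm112_bsdTwo_twist)
    (h33 : KrizLi2019.thm33_rank_twist) (hS31 : bsdTriple_of_analyticRank_le_one_of_conductor_lt)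
    (hBF : bsdTriple_of_hasCM_of_L_one_ne_zero) (hmod : hasEntireLFunction_rat)
    (hGZK : rank_eq_analyticRank_of_analyticRank_le_one) (hCassels : bsdRHS_eq_of_isIsogenous)
    (hSD : HasKrizLiStarDatum curve1728a1 (sqrtField (-23))) :
    ∀ r ∈ recordsKrizLiSeventeenTwentyEightA, ∀ (W' : WeierstrassCurve ℚ) [W'.IsElliptic] [W'.IsGloballyMinimal],
      (IsIsogenous W' (curve1728a1.quadraticTwist ((r.d : ℤ) : ℚ)) ∨
        IsIsogenous W' (curve1728a1.quadraticTwist ((-23 * (r.d : ℤ) : ℤ) : ℚ))) → BSDp W' 2 :=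
  fun r hr W' _ _ hiso =>
    bsdp_two_of_klCertified_1728a1 hKL h33 hS31 hBF hmod hGZK hCassels hSD certified_recordsKrizLiSeventeenTwentyEightA r hr
      ((params_and_base_of_recordsKrizLiSeventeenTwentyEightA).2 r hr).1 ((params_and_base_of_recordsKrizLiSeventeenTwentyEightA).2 r hr).2.1
      ((params_and_base_of_recordsKrizLiSeventeenTwentyEightA).2 r hr).2.2.1 W' hiso

/-- **The Kriz–Li family at `(1728v1, ℚ(√-23))`, member by member, BY NAME**: for each of the 7 certified
records `r` of `recordsKrizLiSeventeenTwentyEightV`, `BSD(W′, 2)` for every globally minimal `W′` `ℚ`-isogenous to `1728v1^{(r.d)}`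
or `1728v1^{(-23·r.d)}`, granted the seven facts and the displayed (★)-certificate `hSD`.
[cite: KrizLi2019, Thm. 1.12 (FMS Thm. 5.1 (2)), Def. 4.1, Lemma 5.1 and §6 Ex. 6.2] [cite: CreutzMiller2012, Thm. 1.1] [cite: BurungaleFlach2024, Thm. 1.1 and Cor. 2]
[cite: MilneADT2006, Thm. I.7.3] [cite: Miller2011LMS, Def. 1.1] -/
theorem bsdp_two_of_mem_recordsKrizLiSeventeenTwentyEightV (hKL : KrizLi2019.thm112_bsdTwo_twist)
    (h33 : KrizLi2019.thm33_rank_twist) (hS31 : bsdTriple_of_analyticRank_le_one_of_conductor_lt)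
    (hBF : bsdTriple_of_hasCM_of_L_one_ne_zero) (hmod : hasEntireLFunction_rat)
    (hGZK : rank_eq_analyticRank_of_analyticRank_le_one) (hCassels : bsdRHS_eq_of_isIsogenous)
    (hSD : HasKrizLiStarDatum curve1728v1 (sqrtField (-23))) :
    ∀ r ∈ recordsKrizLiSeventeenTwentyEightV, ∀ (W' : WeierstrassCurve ℚ) [W'.IsElliptic] [W'.IsGloballyMinimal],
      (IsIsogenous W' (curve1728v1.quadraticTwist ((r.d : ℤ) : ℚ)) ∨
        IsIsogenous W' (curve1728v1.quadraticTwist ((-23 * (r.d : ℤ) : ℤ) : ℚ))) → BSDp W' 2 :=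
  fun r hr W' _ _ hiso =>
    bsdp_two_of_klCertified_1728v1 hKL h33 hS31 hBF hmod hGZK hCassels hSD certified_recordsKrizLiSeventeenTwentyEightV r hr
      ((params_and_base_of_recordsKrizLiSeventeenTwentyEightV).2 r hr).1 ((params_and_base_of_recordsKrizLiSeventeenTwentyEightV).2 r hr).2.1
      ((params_and_base_of_recordsKrizLiSeventeenTwentyEightV).2 r hr).2.2.1 W' hiso

end Summit.BirchSwinnertonDyer.Rank1Residual.P2

end
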